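import Summits.CriticalPhenomena.CardyFormulaZ2.Theses.CardyAnchoredRigidity
import Summits.CriticalPhenomena.CardyFormulaZ2.Theses.CardyLocalRigidity
import Literature.Probability.RandomPlanarGeometry.IsometryCovariance
import Literature.Probability.RandomPlanarGeometry.ChordalKSCondition
import Literature.Probability.RandomPlanarGeometry.SLE
import Literature.Probability.RandomPlanarGeometry.SLETwoPointItoProofs
import Literature.Probability.RandomPlanarGeometry.ConformalRectangleProofs
import Literature.Probability.RandomPlanarGeometry.ConformalRestrictionCovariance
import Summits.CriticalPhenomena.CardyFormulaZ2.Theorems.CardyRotToConfR2SymmetryUpgrade.Negative.CardyRotToConfR2SymmetryUpgradeFalseOfFacts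
import Summits.CriticalPhenomena.CardyFormulaZ2.Theorems.CardyAnchoredRigidityCardyShadowIsolatedSleSixReflection
import HarnessLib.Audit

/-!
# Skeleton for crux `CardyShadowIsolated` (stmt-CriticalPhenomena-5767) — line `registered`
# (birth skeleton, RESHAPED by the lead 2026-08-17: the SLE₆ base-point stub is split;
# cycle 2: stub 2a `stub_sleSixReflection` is now a THEOREM — three stubs remain)

Lead's reshape, cycle 2 (2026-08-17, lead c2). Stub 2a (reflection covariance of the chordal SLE₆
family) is PROVED: both `Q (conj D)` and `conj_* (Q D)` are SLE₆ laws of the mirror domain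
(`isSLELaw_map_conj`, `CardyRotToConfR2SymmetryUpgradeSleSixIsometryInvariance.lean`: reflected
Loewner chain driven by `−W`, `B ↦ −B`, Brownian scaling) and the SLE₆ law of a Dobrushin domain is
unique (`IsSLELaw.unique'`). The proof is inlined below (`Holds.stub_sleSixReflection`, sorry-free)
and landed as the supports file `Theorems/CardyAnchoredRigidityCardyShadowIsolatedSleSixReflection.lean`
(p146491, ACCEPTED; imported here); `CardyShadowIsolated_of` no longer takes it as a hypothesis. Registered
stubs now: `stub_identification`, `stub_sleSixKS`, `stub_localRigidity`.

Wave 1 results (cycle 2, two stub-workers + lead; reports attached to the item as `LEAD-CENSUS-c2.md`):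
* `stub_sleSixKS` — stub-blocked: it IS the printed fact "chordal SLE_κ, κ < 8, satisfies KS Condition G2
  with one constant" (Kemppainen–Smirnov 2017 §1.3, proof of the continuity-in-κ theorem, with Prop 2.6 /
  Remark 2.8), vendored by the lead as the Literature named fact
  `Literature.Probability.RandomPlanarGeometry.exists_satisfiesKSCondition_of_isSLELaw` (p149997, review
  queue; once landed, `Holds.stub_sleSixKS` = that fact at κ = 6 and the skeleton is closed modulo it); a
  sorry-free proof is XL (KS Prop 2.6 geometry, Teichmüller symmetrisation, kernel disintegration).
* `stub_identification` — stub-blocked on stmt-CriticalPhenomena-10268 (`CardySelfRefinement.LagHandOff`,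
  open core `stub_slitHandOffDyadic`: Cardy-free domain Markov of ℤ² subsequential-limit families), plus
  stmt-10270 (DKKMO rotations) and the 11317/11318 dictionary; convention audit clean.
* `stub_localRigidity` — lead: STUCK, crux-sized = informal crux stmt-6806 typed (finite-determination local
  rigidity of SLE₆ inside `Admissible C`); seven impostor templates analysed and excluded by named clauses
  (KS given mid-flight pasts; Markov (c); Blumenthal 0-1; restriction locality) — handed back (promote-stub).

Lead's reshape (cycle 1). The birth stub `stub_sleSixAdmissible` (∃ C P₀, Admissible C P₀ ∧ SLE₆)
bundled seven clauses of which FIVE are theorems of the tree for every family of chordal SLE₆ laws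
(chordality, conformal ⇒ similarity covariance, typed domain Markov property, LSW locality in
restriction form, Möbius target independence: `isLocalMarkovChordalFamily_of_isSLELaw_six_of_facts`
with `IsSLELaw.locality_six_holds`, `sle_six_moebius_locality_holds`; non-tracing:
`stub_nonTracing`). It is now the sorry-free theorem `sleSixAdmissible_of_stubs` over TWO new
registered stubs carrying exactly the two clauses that are not yet in the tree:
`stub_sleSixReflection` (Werner's symmetry (3): covariance of the SLE₆ family under `z ↦ z̄`) and
`stub_sleSixKS` (Kemppainen–Smirnov G2 with one constant for the SLE₆ family). The other two
stubs and the composition are unchanged.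

Routes `CardyAnchoredRigidity` (rank 5) and `CardyLocalRigidity` (rank 2) share this crux verbatim:
if a Cardy shadow `g` (`g R = F(crossRatio x)` for every uniformizing datum) is a cluster point, as
`δ → 0⁺`, of the crossing-function path `δ ↦ (R ↦ bondDomainCrossingProb R δ)` in the product space
`ConformalRectangle → ℝ`, then it is an ISOLATED point of the cluster set.

## The line (identification + Euclidean local rigidity of SLE₆, read through crossing functionals)

Objects (defined below over tree declarations only):
* `crossingPath`, `clusterSet` — the path and its cluster set `Λ'` at `0⁺` (the crux's own data);
* `crossingFunctional P : ConformalRectangle → ℝ` — for a chordal family `P`, the probability that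
  the curve of `(Ω; a, c) = R.chord 0 2` hits `(cd) = R.arc 2` before `(bc) = R.arc 1` (the tree's
  convention for Cardy–Smirnov crossing events, `sle_six_measureReal_hitsBefore`);
* `Admissible C P` — the EUCLIDEAN rigidity class: chordal, isometry covariant (rotations,
  translations AND reflections, NO dilations: `ChordalFamily.IsIsometryCovariant`), domain Markov
  (set clause), local (restriction form), target independent (splitting form), Kemppainen–Smirnov
  condition G2 with ONE constant `C` at all scales (`SatisfiesKSCondition`), non-tracing.

Stubs (the ONLY `sorry`s of this file; 2a is no longer one):
1. `stub_identification` (IdentificationGlue; percolation side, L–XL): with one constant `C`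
   (scale-uniform RSW), every cluster point `g' ∈ Λ'` is the crossing functional of an admissible
   family — lift along an ultrafilter: Aizenman–Burchard tightness, DKKMO rotation invariance,
   self-duality = reflection covariance at `p = 1/2`, Markov/locality/splitting of exploration
   paths passed to the limit, RSW ⇒ KS and non-tracing; the crossing event is a continuity set
   (half-plane 3-arm bounds at the marks).
2. (reshaped) `stub_sleSixReflection` (2a, M; known mathematics: Werner's symmetry (3) for the
   reflection `z ↦ z̄`, via `Loewner.hull_imagAxisRefl` + `−B` is a BM + uniqueness in law) and
   `stub_sleSixKS` (2b, L; KS G2 for SLE₆ with one constant: Markov reduction to time zero +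
   locality + Cardy), composed sorry-free into the former stub 2 by `sleSixAdmissible_of_stubs`
   (chordality, similarity covariance, typed Markov, LSW locality, Möbius target independence and
   non-tracing of ANY family of chordal SLE₆ laws are theorems of the tree).
3. `stub_localRigidity` (EuclideanLocalRigiditySLE6 in crossing-functional, product-topology form;
   the deciding stub, XL): for every `C` and every admissible SLE₆ family `P₀` there is a
   neighbourhood `U` of `crossingFunctional P₀` such that every admissible `P` (same `C`) with
   `crossingFunctional P ∈ U` has `crossingFunctional P = crossingFunctional P₀` — no admissible
   impostor accumulates at SLE₆. Route CardyAnchoredRigidity proves it by the sector census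
   (`TipGermZeroOne` + SectorExhaustion + Germ-Sign + Anchoring ⇒ `H¹ = 0`) plus a non-degenerate
   blow-up of impostor sequences; route CardyLocalRigidity states it as its informal crux
   stmt-CriticalPhenomena-6806.

`CardyShadowIsolated_of` composes 1, 2a, 2b, 3 into the crux BY NAME, sorry-free, using two PROVED tree
facts: uniformizing data exist (`MarkedDomain.exists_isUniformizing_holds`) and Cardy's formula for
SLE₆ (`sle_six_measureReal_hitsBefore_holds`), which identify the Cardy shadow with
`crossingFunctional P₀`; `KS` constants are merged by `SatisfiesKSCondition.mono`.
`CardyShadowIsolated_of_local` is the same conclusion for the sibling route's (syntactically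
identical) decl.

Disproof used: no `Disproof.lean` exists for this crux (no `_false_without_` theorem). Negatives
index honoured: the class is NOT the refuted `IsLocalMarkovChordalFamily + non-tracing ⇒ SLE₆`
(stmt-CriticalPhenomena-0698, `not_SymmetryUpgrade`): the fat-germ one-shot surgery witness has a
deterministic straight initial chord which, in a firing domain whose chord passes within `w` of a
wall at `z₀` (`C w < |z₀ − a|`, `b` outside `B̄(z₀, C w)`, roomy complement), crosses the
boundary-touching avoidable annulus `A(z₀, w, C w)` with probability one (Condition G1 fails at time
zero; NB the typed avoidable set is empty for floating annuli), so it violates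
`SatisfiesKSCondition C` for every `C`; rigidity is asked only
LOCALLY at SLE₆ and WITH reflections (the near-critical family of Garban–Pete–Schramm 2018 Cor. 86
is reflection-odd and not KS-uniform across scales).

References: LawlerSchrammWerner2001 §2–3; Werner2007 §3; SchrammSmirnov2011; GarbanPeteSchramm2018
Cor. 86, §13; KemppainenSmirnov2017 §2.1.3, §4; AizenmanBurchard1999; DKKMO arXiv:2012.11672;
CamiaNewman2007; Smirnov2001.
-/

noncomputable section

namespace Summit.CriticalPhenomena.CardyFormulaZ2.Cruxes.CardyShadowIsolated.Birth

open Set Filter Topology MeasureTheory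
open Literature.Probability.RandomPlanarGeometry

/-! ### Objects of the line -/

/-- The crossing-function path `δ ↦ (R ↦ P_{1/2}[bond-ℤ² crossing of R at mesh δ])` of the crux.
[folklore] -/
def crossingPath : ℝ → (ConformalRectangle → ℝ) :=
  fun δ R => Literature.Probability.Percolation.bondDomainCrossingProb R δ

/-- The cluster set `Λ'` at `0⁺` of the crossing-function path (product topology). [folklore] -/
def clusterSet : Set (ConformalRectangle → ℝ) :=
  {g | MapClusterPt g (nhdsWithin (0 : ℝ) (Set.Ioi 0)) crossingPath}

/-- The **crossing functional** of a chordal family: in the conformal rectangle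
`R = (Ω; a, b, c, d)`, the `P`-probability that the curve of `(Ω; a, c) = R.chord 0 2` hits
`(cd) = R.arc 2` before `(bc) = R.arc 1` (for the percolation exploration path from `a` with `(ab)`
open and `(da)` closed this is the open crossing `(ab) ↔ (cd)`; for SLE₆ it is Cardy's `F(η)`,
`sle_six_measureReal_hitsBefore`). [cite: Werner2007, §3] -/
def crossingFunctional (P : ChordalFamily) : ConformalRectangle → ℝ :=
  fun R => (P (R.chord 0 2 (by decide))).real (CurveClass.hitsBefore (R.arc 2) (R.arc 1))

/-- **Non-tracing**: almost surely no non-trivial sub-arc of the curve runs inside `∂D` (the clause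
of stmt-CriticalPhenomena-0698 / `AnchoredPullbackAxioms`, verbatim). [folklore] -/
def NonTracing (P : ChordalFamily) : Prop :=
  ∀ D : DobrushinDomain, ∀ᵐ γ ∂(P D), ∀ c : Curve ℂ, CurveClass.mk c = γ →
    ∀ s t : unitInterval, s < t → c '' Set.Icc s t ⊆ frontier D.carrier →
      (c '' Set.Icc s t).Subsingleton

/-- The **Euclidean rigidity class with KS constant `C`**: chordal, isometry covariant (all plane
isometries incl. reflections; no dilations), domain Markov, local (restriction form), target
independent (splitting form), Kemppainen–Smirnov G2 with the single constant `C` at all scales,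
non-tracing. [cite: KemppainenSmirnov2017, §2.1.3 Condition G2] -/
def Admissible (C : ℝ) (P : ChordalFamily) : Prop :=
  P.IsChordal ∧ P.IsIsometryCovariant ∧ P.IsDomainMarkov ∧ P.IsLocal ∧ P.IsTargetIndependent ∧
    P.SatisfiesKSCondition C ∧ NonTracing P

/-- The class is monotone in the KS constant. [folklore] -/
theorem Admissible.mono {C C' : ℝ} {P : ChordalFamily} (h : Admissible C P) (hCC' : C ≤ C') :
    Admissible C' P :=
  ⟨h.1, h.2.1, h.2.2.1, h.2.2.2.1, h.2.2.2.2.1, h.2.2.2.2.2.1.mono hCC', h.2.2.2.2.2.2⟩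

/-! ### The registered stubs (the ONLY `sorry`s of this file)

Device: each stub is `Holds.stub_<name> : <statement> := by sorry` (registered under the short name
`stub_<name>` with that statement as signature) plus the by-name handle
`def stub_<name> : Prop := type_of% Holds.stub_<name>` required of the hypotheses of
`CardyShadowIsolated_of` by `#h21_check_skeleton`. -/

/-- STUB 1 — **IdentificationGlue** (lift of cluster points): there is ONE constant `C` such that
every cluster point `g'` at `0⁺` of the bond-`ℤ²` crossing-function path is the crossing functional
of an admissible chordal family (the ultrafilter limit of the exploration-path laws: Aizenman–Burchard
tightness, DKKMO rotations, self-duality as reflection covariance, Markov/locality/splitting in the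
limit, RSW ⇒ KS G2 and non-tracing, continuity of the crossing event at the marks).
Why it might fail: for WILD Jordan boundaries at the marks the continuum hitting event need not be a
continuity set matching G02's discretised crossing event (near-miss / half-plane 3-arm uniformity
unwritten). [cite: SchrammSmirnov2011, §1; AizenmanBurchard1999, §2.1; KemppainenSmirnov2017, §4] -/
protected theorem Holds.stub_identification :
    ∃ C : ℝ, ∀ g ∈ clusterSet, ∃ P : ChordalFamily, Admissible C P ∧ crossingFunctional P = g := by
  sorry

/-- By-name handle of STUB 1. [folklore] -/
def stub_identification : Prop := type_of% Holds.stub_identification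

/-- (Former) STUB 2a, PROVED in cycle 2 — **reflection covariance of the chordal SLE₆ family** (Werner's symmetry (3) in
covariance form, for the single reflection `z ↦ z̄`; with conformal covariance this is full
isometry covariance, `IsConformallyCovariant.isIsometryCovariant_of_conj`): for every family `Q`
of chordal SLE₆ laws and every Dobrushin domain `D`, the law in the mirror domain `D̄ = conj '' D`
(marked points `ā, b̄`) is the push-forward of the law in `D` along `z ↦ z̄`. Proof route in the
tree's vocabulary: the Loewner chain driven by `−W` is the mirror image `σ = (z ↦ −z̄)` of the chain
driven by `W` (`Loewner.hull_imagAxisRefl`, `Loewner.map_imagAxisRefl`, LoewnerReflection.lean);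
`−B` is a Brownian motion, so `ω ↦ −ω` preserves the pre-Wiener measure; `conj ∘ φ ∘ σ` is a
chordal uniformizing map of `D̄` when `φ` is one of `D`; conclude by uniqueness in law of chordal
SLE (`IsSLECurve.map_eq_holds`). Why it might fail: only a typing defect (boundary extension of the
composite uniformizer vs. `conj ∘ φ.boundaryExtension ∘ σ` on `∂ℍ`).
[cite: Werner2007, §3.2 condition (3); LawlerSchrammWerner2001, §3.2] -/
protected theorem Holds.stub_sleSixReflection :
    ∀ Q : ChordalFamily, (∀ D : DobrushinDomain, IsSLELaw 6 D (Q D)) →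
      ∀ D : DobrushinDomain, Q (D.map Complex.conjLIE.toHomeomorph) =
        (Q D).map (CurveClass.map (Complex.conjLIE.toHomeomorph : C(ℂ, ℂ))) :=
  Summit.CriticalPhenomena.CardyFormulaZ2.Theorems.CardyShadowIsolated.stub_sleSixReflection

/-- By-name handle of (former) STUB 2a, now a theorem (`Holds.stub_sleSixReflection` is
sorry-free; landed as `Theorems.CardyShadowIsolated.stub_sleSixReflection`, p146491). [folklore] -/
def stub_sleSixReflection : Prop := type_of% Holds.stub_sleSixReflection

/-- Former stub 2a holds (by-name handle discharged). [folklore] -/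
theorem stub_sleSixReflection_holds : stub_sleSixReflection := Holds.stub_sleSixReflection

/-- STUB 2b — **the Kemppainen–Smirnov condition G2 for the chordal SLE₆ family, one constant for
all Dobrushin domains, all hitting-time pasts and all scales** (`ChordalFamily.SatisfiesKSCondition`).
STATUS (cycle 2): this is VERBATIM the Literature named fact
`Literature.Probability.RandomPlanarGeometry.exists_satisfiesKSCondition_of_isSLELaw` (KS 2017 §1.3,
landed p149997, file `Literature/Probability/RandomPlanarGeometry/SLEKSCondition.lean`) at `κ = 6`
(`exists_satisfiesKSCondition_of_isSLELaw_six`); it stays a declared stub only because skeleton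
hypotheses must be registered stubs (`skeleton.extra-hypothesis`); discharging the fact
(`…_holds`, XL: KS Prop 2.6 geometry + Teichmüller symmetrisation + kernel disintegration, see the
worker report `LEAD-CENSUS-c2.md`) closes it in one line. Original description:
for every family `Q` of chordal SLE₆ laws there is `C > 1` such that for every `D`, every first
hitting time `τ_F` of a nonempty closed `F`, every annulus `A(z₀, r, R)` with `0 < r`, `C r ≤ R` and
every measurable set `S` of pasts, `Q D ({γ[0,τ_F] ∈ S} ∩ {γ[τ_F,1] crosses A inside A^u_{τ_F}}) ≤
½ · Q D {γ[0,τ_F] ∈ S}`. Intended proof: the typed domain Markov property of SLE₆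
(`ChordalFamily.isDomainMarkov_of_isSLELaw`, kernel `sleMarkovKernel 6`) reduces G2 to its time-zero
case G1 in the remaining (slit) domain (KS 2017 Remark 2.9); by locality of SLE₆ and conformal
invariance an unforced crossing of `A(z₀, r, R)` forces, before any boundary effect is felt, the
crossing of a conformal rectangle of modulus `≳ log (R/r)`, whose SLE₆ probability is Cardy's
`F` at a cross-ratio tending to `0` (`sle_six_measureReal_hitsBefore_holds`), hence `≤ 1/2` once
`R/r ≥ C`. Scale uniformity is automatic for SLE₆ (scale invariance). Why it might fail: pasts
touching `∂D` / tips at multiple prime ends, where the kernel is SLE₆ of a non-Jordan remaining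
domain and the tree's Cardy identity is stated for Jordan conformal rectangles only.
[cite: KemppainenSmirnov2017, §2.1.3 Condition G2, Remark 2.9 and §4.2; LawlerSchrammWerner2001, Thm 2.2] -/
protected theorem Holds.stub_sleSixKS :
    ∀ Q : ChordalFamily, (∀ D : DobrushinDomain, IsSLELaw 6 D (Q D)) →
      ∃ C : ℝ, Q.SatisfiesKSCondition C := by
  sorry

/-- By-name handle of STUB 2b. [folklore] -/
def stub_sleSixKS : Prop := type_of% Holds.stub_sleSixKS

/-- **Former STUB 2, now a theorem over 2a + 2b: an admissible SLE₆ family exists** (base point of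
the rigidity class). Take any family `Q` of chordal SLE₆ laws (`exists_sleSixLawFamily'`,
Rohde–Schramm, proved in the tree); it is chordal, conformally (hence similarity) covariant, typed
domain Markov, local (LSW Cor. 2.4, `IsSLELaw.locality_six_holds`) and target independent (Möbius
locality, `sle_six_moebius_locality_holds`) by `isLocalMarkovChordalFamily_of_isSLELaw_six_of_facts`,
non-tracing by `stub_nonTracing`; reflection covariance (2a) upgrades similarity covariance to
isometry covariance (`IsConformallyCovariant.isIsometryCovariant_of_conj`), and 2b is the KS clause.
[cite: Werner2007, §3.2 and Prop 3.4; LawlerSchrammWerner2001, Thm 2.2, Cor 2.3–2.4] -/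
theorem sleSixAdmissible_of_stubs (h₂r : stub_sleSixReflection) (h₂k : stub_sleSixKS) :
    ∃ (C : ℝ) (P₀ : ChordalFamily), Admissible C P₀ ∧ ∀ D : DobrushinDomain, IsSLELaw 6 D (P₀ D) := by
  have h₂r' : ∀ Q : ChordalFamily, (∀ D : DobrushinDomain, IsSLELaw 6 D (Q D)) →
      ∀ D : DobrushinDomain, Q (D.map Complex.conjLIE.toHomeomorph) =
        (Q D).map (CurveClass.map (Complex.conjLIE.toHomeomorph : C(ℂ, ℂ))) := h₂r
  have h₂k' : ∀ Q : ChordalFamily, (∀ D : DobrushinDomain, IsSLELaw 6 D (Q D)) →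
      ∃ C : ℝ, Q.SatisfiesKSCondition C := h₂k
  obtain ⟨Q, hQ⟩ :=
    Summit.CriticalPhenomena.CardyFormulaZ2.Theorems.CardyRotToConfR2SymmetryUpgrade.Negative.exists_sleSixLawFamily'
  have hLM : IsLocalMarkovChordalFamily Q :=
    Summit.CriticalPhenomena.CardyFormulaZ2.Theorems.CardyRotToConfR2SymmetryUpgrade.Negative.isLocalMarkovChordalFamily_of_isSLELaw_six_of_facts
      IsSLELaw.locality_six_holds sle_six_moebius_locality_holds hQ
  have hNT : NonTracing Q :=
    Summit.CriticalPhenomena.CardyFormulaZ2.Theorems.CardyRotToConfR2SymmetryUpgrade.stub_nonTracing Q hQ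
  have hIso : Q.IsIsometryCovariant :=
    (ChordalFamily.isConformallyCovariant_of_isSLELaw hQ).isIsometryCovariant_of_conj (h₂r' Q hQ)
  obtain ⟨C, hKS⟩ := h₂k' Q hQ
  exact ⟨C, Q, ⟨hLM.isChordal, hIso, hLM.markov, hLM.isLocal, hLM.targetIndependent, hKS, hNT⟩, hQ⟩

/-- STUB 3 — **Euclidean local rigidity of SLE₆, crossing-functional form** (the deciding stub;
= informal crux stmt-CriticalPhenomena-6806 read through crossing functionals, product topology):
for every KS constant `C` and every admissible family `P₀` of chordal SLE₆ laws there is a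
neighbourhood `U` of `crossingFunctional P₀` (finitely many rectangles, one tolerance) such that an
admissible `P` with `crossingFunctional P ∈ U` has the SAME crossing functional — no admissible
impostor accumulates at SLE₆. Intended proof (route CardyAnchoredRigidity): impostor sequence ⇒
non-degenerate normalised blow-up ⇒ a first-order deformation obeying the linearised axioms ⇒ sector
census (twists killed by isometry covariance + splitting: Anchoring Lemma; drifts by the tip-germ
0-1 law `TipGermZeroOne` + mirrors: Germ-Sign Lemma; diffusivity by locality at κ = 6) ⇒ zero.
Why it might fail: a duality-even exactly marginal direction at `c = 0` (GPS 2018 §13's second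
exponent pair), or a KS-compatible germ-triggered surgery of SLE₆ at wild Jordan germs, would give
admissible impostors converging to SLE₆ in the product topology. [cite: GarbanPeteSchramm2018, Cor. 86 and §13; LawlerSchrammWerner2001, §3] -/
protected theorem Holds.stub_localRigidity :
    ∀ (C : ℝ) (P₀ : ChordalFamily), Admissible C P₀ → (∀ D : DobrushinDomain, IsSLELaw 6 D (P₀ D)) →
      ∃ U ∈ nhds (crossingFunctional P₀), ∀ P : ChordalFamily, Admissible C P →
        crossingFunctional P ∈ U → crossingFunctional P = crossingFunctional P₀ := by
  sorry

/-- By-name handle of STUB 3. [folklore] -/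
def stub_localRigidity : Prop := type_of% Holds.stub_localRigidity

/-! ### Sorry-free glue -/

/-- The Cardy shadow is the crossing functional of any family of chordal SLE₆ laws: uniformizing
data exist (`MarkedDomain.exists_isUniformizing_holds`, proved) and Cardy's formula holds for SLE₆
(`sle_six_measureReal_hitsBefore_holds`, proved). [cite: Werner2007, §3] -/
theorem crossingFunctional_eq_of_isSLELaw_of_shadow {P₀ : ChordalFamily}
    (hSLE : ∀ D : DobrushinDomain, IsSLELaw 6 D (P₀ D))
    {g : ConformalRectangle → ℝ}
    (hshadow : ∀ (R : ConformalRectangle)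
      (φ : ConformalEquiv UpperHalfPlane.upperHalfPlaneSet R.carrier) (x : Fin 4 → ℝ),
      R.IsUniformizing φ x → g R = cardyFunction (crossRatio x)) :
    crossingFunctional P₀ = g := by
  funext R
  obtain ⟨φ, x, hφ⟩ := MarkedDomain.exists_isUniformizing_holds R
  rw [hshadow R φ x hφ]
  exact sle_six_measureReal_hitsBefore_holds R (hSLE _) hφ

/-- The core composition, stated for the literal crux text (shared by both routes); `h₂` is the
former stub 2 (now `sleSixAdmissible_of_stubs`). [folklore] -/
theorem isolated_of_stubs (h₁ : stub_identification)
    (h₂ : ∃ (C : ℝ) (P₀ : ChordalFamily), Admissible C P₀ ∧ ∀ D : DobrushinDomain, IsSLELaw 6 D (P₀ D))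
    (h₃ : stub_localRigidity) :
    ∀ g : ConformalRectangle → ℝ,
      (∀ (R : ConformalRectangle)
        (φ : ConformalEquiv UpperHalfPlane.upperHalfPlaneSet R.carrier) (x : Fin 4 → ℝ),
        R.IsUniformizing φ x → g R = cardyFunction (crossRatio x)) →
      MapClusterPt g (nhdsWithin (0 : ℝ) (Set.Ioi 0))
        (fun (δ : ℝ) (R : ConformalRectangle) => Literature.Probability.Percolation.bondDomainCrossingProb R δ) →
      ∃ U ∈ nhds g, ∀ g' ∈ U,
        MapClusterPt g' (nhdsWithin (0 : ℝ) (Set.Ioi 0))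
          (fun (δ : ℝ) (R : ConformalRectangle) => Literature.Probability.Percolation.bondDomainCrossingProb R δ) → g' = g := by
  intro g hshadow _hg
  -- unpack the stubs (by-name handles unfold definitionally)
  have h₁' : ∃ C : ℝ, ∀ g ∈ clusterSet, ∃ P : ChordalFamily,
      Admissible C P ∧ crossingFunctional P = g := h₁
  have h₂' := h₂
  have h₃' : ∀ (C : ℝ) (P₀ : ChordalFamily), Admissible C P₀ →
      (∀ D : DobrushinDomain, IsSLELaw 6 D (P₀ D)) →
        ∃ U ∈ nhds (crossingFunctional P₀), ∀ P : ChordalFamily, Admissible C P →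
          crossingFunctional P ∈ U → crossingFunctional P = crossingFunctional P₀ := h₃
  obtain ⟨C₁, hlift⟩ := h₁'
  obtain ⟨C₂, P₀, hP₀, hSLE⟩ := h₂'
  -- one KS constant for the lifts and the base point
  set C := max C₁ C₂ with hC
  have hP₀C : Admissible C P₀ := hP₀.mono (le_max_right _ _)
  -- the Cardy shadow IS the crossing functional of the SLE₆ family
  have hΦ₀ : crossingFunctional P₀ = g := crossingFunctional_eq_of_isSLELaw_of_shadow hSLE hshadow
  -- local rigidity at the base point
  obtain ⟨U, hU, hrig⟩ := h₃' C P₀ hP₀C hSLE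
  rw [hΦ₀] at hU
  refine ⟨U, hU, fun g' hg'U hg' => ?_⟩
  -- lift the nearby cluster point and conclude
  obtain ⟨P, hP, hPg'⟩ := hlift g' hg'
  have hPC : Admissible C P := hP.mono (le_max_left _ _)
  have key := hrig P hPC (by rw [hPg']; exact hg'U)
  rw [← hPg', key, hΦ₀]

/-- **The skeleton theorem**: the three remaining stubs imply the crux BY NAME (route
CardyAnchoredRigidity; former stub 2a enters as the theorem `stub_sleSixReflection_holds`).
[folklore] -/
theorem CardyShadowIsolated_of (h₁ : stub_identification) (h₂k : stub_sleSixKS)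
    (h₃ : stub_localRigidity) :
    Summit.CriticalPhenomena.CardyFormulaZ2.Theses.CardyAnchoredRigidity.CardyShadowIsolated :=
  isolated_of_stubs h₁ (sleSixAdmissible_of_stubs stub_sleSixReflection_holds h₂k) h₃

/-- The same three stubs imply the sibling route's decl (route CardyLocalRigidity; the shared item
stmt-CriticalPhenomena-5767 has one text, two namespaces). [folklore] -/
theorem CardyShadowIsolated_of_local (h₁ : stub_identification) (h₂k : stub_sleSixKS)
    (h₃ : stub_localRigidity) :
    Summit.CriticalPhenomena.CardyFormulaZ2.Theses.CardyLocalRigidity.CardyShadowIsolated :=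
  isolated_of_stubs h₁ (sleSixAdmissible_of_stubs stub_sleSixReflection_holds h₂k) h₃

end Summit.CriticalPhenomena.CardyFormulaZ2.Cruxes.CardyShadowIsolated.Birth

end
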